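import Summits.QuantumFields.BalabanUV.Beta.GAN24.CombExchangeESectorValue
import Summits.QuantumFields.BalabanUV.Beta.GAN24.ExchangeESectorLatticeWords

/-!
# `BalabanUV.Beta.GAN24.CombExchangeESectorLatticeWords` — binder row G-an2-4 ∕ (CONV-C), W-slot CT-W, the COMB chart (III′), J2_comb step T4 = **J2_comb(j+1): THE TWO LITERAL
# `E ⊗ E` LATTICE WORDS OVER THE (UNTRANSPORTED) COMB CUBIC SECTOR `W_j = cE • e3OfK Lc G_j (𝒯S̃comb_j)` ARE AN ENTRYWISE ANTISYMMETRIC PAIR FORM AT EVERY LEVEL** — leaf-06 g54's J2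
# `ExchangeESectorLatticeWords` TOKEN FOR TOKEN with the member replaced (the Ward pins inside `S̃comb_j`, any amplitude `cE`, kernel root `toSite (ctrOff (d+1) Lc)`; the shape of OWNER
# gan24-p1 g53's `hR` in `CombForcingPairFormSucc.pairFormLS_combForcing_succ_of_pairForm`, journal l.67678): `EE_direct + EE_swap = R(κκ₁;κ′κ₂) + R(κ′κ₁;κκ₂)`, `R` antisymmetric in each pair,
# EXPLICIT (`R(μα;νβ) = [μ≠α][ν≠β]·|box|·c₀σ_{j+1}²·(K_E(−½))(K_E·½)·s_f²·wVH_{j+1}⁻¹·P(μα;νβ)`, the SAME pattern table `P` as the spine's)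

NOT IN PRINT; OUR BOOKKEEPING ([folklore] BY NAME: leaf-06's generic `ExchangeLatticeWordReduced.sum_box_literal_eq_reduced ∕ _swap_`, `ExchangeESectorPattern.pairing_antisymm_left ∕ _right`,
my T2 `CombExchangeESectorStaircase.locStencil_sectorTable ∕ sectorTable_translate`, T3 `CombExchangeESectorValue.*`; G-an2-4 formalisation swarm, leaf prover
`b2b-balaban-gan24-formalise-leaf-01`, gen 87, file T4; 0 `def`, 0 cited facts, 0 `def … : Prop`, 0 sorry).  WHAT: §1 `sectorTable_inl_inr ∕ _inr_inl`; §2 `eeDirect_eq_exchangeWord`,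
`eeSwap_eq_exchangeWord`; §3 `exchangeWord_eq_pairEntry`, `eeWords_eq_pairForm` (leaf-06's member-free `pairEntry_antisymm_fst ∕ _snd` reused BY NAME), **`exists_pairForm_eeWords`**, **`exists_pairForm_eeWords_smul`** — same names
as leaf-06's, namespace `CombExchangeESectorLatticeWords`, signatures `(cΛt sf sm cE cΛ : ℝ) (j : ℕ) …`.  Asserts NO value of Bałaban's tables beyond an2's ∕ an1's DEFINED ones; this is
the `E ⊗ E` pair form of the UNTRANSPORTED comb sector (OWNER Y0 `CombEEWordTransferStep` carries it to the transported word); NEVER «G-an2-4 closed» as (CONV-C); NOT D1, NOT `BetaPertH`,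
NOT continuum, NOT Clay.  2026-08-27; no existing file touched.

HONEST FRAMING (cell contract, verbatim): «discharging `BetaPertH` makes Bałaban's UV stability UNCONDITIONAL — a real constructive-QFT result; it is NOT the continuum limit and NOT the
Clay problem.»  HONEST DEPENDENCY (verbatim): «continuum YM on T⁴ ⇐ BetaPertH ∧ nine spine estimates (0/9 proved); BetaPertH ⇐ (D1) ∧ (D4) ∧ CAP+tail; G-an2-4 gates asym, D1 and NE2/3/4.»
-/

noncomputable section

open Finset
open scoped BigOperators
open Literature.MathematicalPhysics.QuantumFieldTheory
open Literature.MathematicalPhysics.QuantumFieldTheory.Balaban1983to89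
open Literature.MathematicalPhysics.QuantumFieldTheory.Balaban1983to89.Beta
open ExpKernelCalculus (Site MKer comp shiftK)
open OneStepResolventKernel (Fib LocStencil)
open OneStepKernelFamily (KInvStep vertexOfK)
open AffineAveraging (box toSite)
open BalabanStepJetsSucc (E2 wVH)
open Summit.QuantumFields.BalabanUV.Beta.AxialDressingRooted (coDressKBmAt one_le_of_neZero)
open Summit.QuantumFields.BalabanUV.Beta.HessKerDressedUnits (unitK unitS)
open Summit.QuantumFields.BalabanUV.Beta.SpineRooted (e3OfK)
open Summit.QuantumFields.BalabanUV.Beta.WardLocusRecursive (SrecAt)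
open Summit.QuantumFields.BalabanUV.Beta.GAN24.ExchangeLatticeWordReduced (sum_box_literal_eq_reduced sum_box_swap_literal_eq_reduced)
open Summit.QuantumFields.BalabanUV.Beta.GAN24.ExchangeESectorPattern (pairing_antisymm_right pairing_antisymm_left)
open Summit.QuantumFields.BalabanUV.Beta.GAN24.ExchangeESectorLatticeWords (pairEntry_antisymm_fst pairEntry_antisymm_snd)

open ExpKernelCalculus (comp)
open AveragingContoursRooted (ctr ctrOff ctrOff_mem_box)
open Summit.QuantumFields.BalabanUV.Beta.TameKernelCalculus (trK)
open Summit.QuantumFields.BalabanUV.Beta.SymSecondOrderTablesAn1 (symTablesAn1S2)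
open Summit.QuantumFields.BalabanUV.Beta.CombChartStepJets (ScombOf)
open Summit.QuantumFields.BalabanUV.Beta.SymCorrectorKernel (psiKS)
open Summit.QuantumFields.BalabanUV.Beta.SymCorrectorFace (slotPsiS)
open Summit.QuantumFields.BalabanUV.Beta.GAN24.CombTransportedBorder (pos_Lc)
open Summit.QuantumFields.BalabanUV.Beta.GAN24.CombExchangeESectorStaircase (locStencil_sectorTable sectorTable_translate)
open Summit.QuantumFields.BalabanUV.Beta.GAN24.CombExchangeESectorValue (exchangeWord_sector_value exchangeWord_sector_eq_zero_of_right_diag exchangeWord_sector_eq_zero_of_left_diag)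
namespace Summit.QuantumFields.BalabanUV.Beta.GAN24.CombExchangeESectorLatticeWords

variable {d : ℕ} {Lc : ℕ} [NeZero Lc]

/-! ## §1 The E-sector table has no field–multiplier blocks -/

/-- [folklore] `S^E_j κ u y z (inl a) (inr m) = 0` (`e3OfK` is minus an `mmRead`, whose mixed blocks are `0` by definition — `StepReflectionRec.e3OfK_inl_inr`). -/
theorem sectorTable_inl_inr (cΛt cE cΛ : ℝ) (j : ℕ) (κ : Fin (d + 1)) (u y z : Site (d + 1)) (a m : Fin (d + 1)) :
    (fun κ u => cE • e3OfK Lc (coDressKBmAt (toSite (ctrOff (d + 1) Lc)) Lc (KInvStep (d := d) Lc j))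
        (fun κ u => comp (comp (trK (psiKS (ctrOff (d + 1) Lc) Lc)) (slotPsiS (ctrOff (d + 1) Lc) Lc (ScombOf (symTablesAn1S2 d Lc cΛt) ((Lc : ℝ) ^ (d + 1)) (-((Lc : ℝ) ^ (d + 1) * (1 / 2) * (Lc : ℝ) ^ (d + 1))) cΛ j) κ u)) (psiKS (ctrOff (d + 1) Lc) Lc)) κ u) κ u y z (Sum.inl a) (Sum.inr m) = 0 := by
  have h0 : e3OfK Lc (coDressKBmAt (toSite (ctrOff (d + 1) Lc)) Lc (KInvStep (d := d) Lc j))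
      (fun κ u => comp (comp (trK (psiKS (ctrOff (d + 1) Lc) Lc)) (slotPsiS (ctrOff (d + 1) Lc) Lc (ScombOf (symTablesAn1S2 d Lc cΛt) ((Lc : ℝ) ^ (d + 1)) (-((Lc : ℝ) ^ (d + 1) * (1 / 2) * (Lc : ℝ) ^ (d + 1))) cΛ j) κ u)) (psiKS (ctrOff (d + 1) Lc) Lc)) κ u y z (Sum.inl a) (Sum.inr m) = 0 := by
    show -(0 : ℝ) = 0
    exact neg_zero
  simp only [Pi.smul_apply, smul_eq_mul, h0, mul_zero]

/-- [folklore] `S^E_j κ u y z (inr m) (inl b) = 0`. -/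
theorem sectorTable_inr_inl (cΛt cE cΛ : ℝ) (j : ℕ) (κ : Fin (d + 1)) (u y z : Site (d + 1)) (m b : Fin (d + 1)) :
    (fun κ u => cE • e3OfK Lc (coDressKBmAt (toSite (ctrOff (d + 1) Lc)) Lc (KInvStep (d := d) Lc j))
        (fun κ u => comp (comp (trK (psiKS (ctrOff (d + 1) Lc) Lc)) (slotPsiS (ctrOff (d + 1) Lc) Lc (ScombOf (symTablesAn1S2 d Lc cΛt) ((Lc : ℝ) ^ (d + 1)) (-((Lc : ℝ) ^ (d + 1) * (1 / 2) * (Lc : ℝ) ^ (d + 1))) cΛ j) κ u)) (psiKS (ctrOff (d + 1) Lc) Lc)) κ u) κ u y z (Sum.inr m) (Sum.inl b) = 0 := by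
  have h0 : e3OfK Lc (coDressKBmAt (toSite (ctrOff (d + 1) Lc)) Lc (KInvStep (d := d) Lc j))
      (fun κ u => comp (comp (trK (psiKS (ctrOff (d + 1) Lc) Lc)) (slotPsiS (ctrOff (d + 1) Lc) Lc (ScombOf (symTablesAn1S2 d Lc cΛt) ((Lc : ℝ) ^ (d + 1)) (-((Lc : ℝ) ^ (d + 1) * (1 / 2) * (Lc : ℝ) ^ (d + 1))) cΛ j) κ u)) (psiKS (ctrOff (d + 1) Lc) Lc)) κ u y z (Sum.inr m) (Sum.inl b) = 0 := by
    show -(0 : ℝ) = 0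
    exact neg_zero
  simp only [Pi.smul_apply, smul_eq_mul, h0, mul_zero]

/-! ## §2 leaf-04's two literal EE lattice words are the reduced exchange word and its bond swap -/

/-- [folklore] **`EE_direct(μ,ν;α,β)` IS THE REDUCED EXCHANGE WORD `W(μ,ν;α,β)`** (every `j`, every axis pattern): the first summand of the right side of leaf-04's
`DressedSourceZeroModeSucc.zmode_dressedSource_succ_inl_inl` (amplitude generic `cE`) equals the left side of `ExchangeESectorValue.exchangeWord_sector_value`
(`ExchangeLatticeWordReduced.sum_box_literal_eq_reduced` at the E-sector table). -/
theorem eeDirect_eq_exchangeWord (cΛt sf sm cE cΛ : ℝ) (j : ℕ) (μ ν α β : Fin (d + 1)) :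
    ∑ c' ∈ box (d + 1) Lc, ∑' u' : Site (d + 1), ∑' yw : Site (d + 1) × Site (d + 1), (if yw.1 α % (Lc : ℤ) = (Lc : ℤ) - 1 then (1 : ℝ) else 0) * (if yw.2 β % (Lc : ℤ) = (Lc : ℤ) - 1 then (1 : ℝ) else 0) *
        comp (comp (vertexOfK (unitK sf sm (coDressKBmAt (toSite (ctrOff (d + 1) Lc)) Lc (KInvStep (d := d) Lc (j + 1)))) Lc
            (unitS sf sm (fun κ t => cE • e3OfK Lc (coDressKBmAt (toSite (ctrOff (d + 1) Lc)) Lc (KInvStep (d := d) Lc j))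
              (fun κ u => comp (comp (trK (psiKS (ctrOff (d + 1) Lc) Lc)) (slotPsiS (ctrOff (d + 1) Lc) Lc (ScombOf (symTablesAn1S2 d Lc cΛt) ((Lc : ℝ) ^ (d + 1)) (-((Lc : ℝ) ^ (d + 1) * (1 / 2) * (Lc : ℝ) ^ (d + 1))) cΛ j) κ u)) (psiKS (ctrOff (d + 1) Lc) Lc)) κ t)) μ (toSite c'))
          (unitK sf sm (coDressKBmAt (toSite (ctrOff (d + 1) Lc)) Lc (KInvStep (d := d) Lc (j + 1)))))
          (vertexOfK (unitK sf sm (coDressKBmAt (toSite (ctrOff (d + 1) Lc)) Lc (KInvStep (d := d) Lc (j + 1)))) Lc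
            (unitS sf sm (fun κ t => cE • e3OfK Lc (coDressKBmAt (toSite (ctrOff (d + 1) Lc)) Lc (KInvStep (d := d) Lc j))
              (fun κ u => comp (comp (trK (psiKS (ctrOff (d + 1) Lc) Lc)) (slotPsiS (ctrOff (d + 1) Lc) Lc (ScombOf (symTablesAn1S2 d Lc cΛt) ((Lc : ℝ) ^ (d + 1)) (-((Lc : ℝ) ^ (d + 1) * (1 / 2) * (Lc : ℝ) ^ (d + 1))) cΛ j) κ u)) (psiKS (ctrOff (d + 1) Lc) Lc)) κ t)) ν u') yw.1 yw.2 (Sum.inl α) (Sum.inl β) =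
      ∑ u ∈ box (d + 1) Lc, ∑' y₁ : Site (d + 1), ∑ a : Fin (d + 1),
        (∑' y : Site (d + 1), (if y α % (Lc : ℤ) = (Lc : ℤ) - 1 then (1 : ℝ) else 0) *
          vertexOfK (unitK sf sm (coDressKBmAt (toSite (ctrOff (d + 1) Lc)) Lc (KInvStep (d := d) Lc (j + 1)))) Lc
            (unitS sf sm (fun κ u => cE • e3OfK Lc (coDressKBmAt (toSite (ctrOff (d + 1) Lc)) Lc (KInvStep (d := d) Lc j))
              (fun κ u => comp (comp (trK (psiKS (ctrOff (d + 1) Lc) Lc)) (slotPsiS (ctrOff (d + 1) Lc) Lc (ScombOf (symTablesAn1S2 d Lc cΛt) ((Lc : ℝ) ^ (d + 1)) (-((Lc : ℝ) ^ (d + 1) * (1 / 2) * (Lc : ℝ) ^ (d + 1))) cΛ j) κ u)) (psiKS (ctrOff (d + 1) Lc) Lc)) κ u)) μ (toSite u) y y₁ (Sum.inl α) (Sum.inl a)) *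
        (∑' z : Site (d + 1), ∑ b : Fin (d + 1), unitK sf sm (coDressKBmAt (toSite (ctrOff (d + 1) Lc)) Lc (KInvStep (d := d) Lc (j + 1))) y₁ z (Sum.inl a) (Sum.inl b) *
          (∑' u' : Site (d + 1), ∑' w : Site (d + 1), (if w β % (Lc : ℤ) = (Lc : ℤ) - 1 then (1 : ℝ) else 0) *
            vertexOfK (unitK sf sm (coDressKBmAt (toSite (ctrOff (d + 1) Lc)) Lc (KInvStep (d := d) Lc (j + 1)))) Lc
              (unitS sf sm (fun κ u => cE • e3OfK Lc (coDressKBmAt (toSite (ctrOff (d + 1) Lc)) Lc (KInvStep (d := d) Lc j))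
                (fun κ u => comp (comp (trK (psiKS (ctrOff (d + 1) Lc) Lc)) (slotPsiS (ctrOff (d + 1) Lc) Lc (ScombOf (symTablesAn1S2 d Lc cΛt) ((Lc : ℝ) ^ (d + 1)) (-((Lc : ℝ) ^ (d + 1) * (1 / 2) * (Lc : ℝ) ^ (d + 1))) cΛ j) κ u)) (psiKS (ctrOff (d + 1) Lc) Lc)) κ u)) ν u' z w (Sum.inl b) (Sum.inl β))) := by
  have hr : ctrOff (d + 1) Lc ∈ box (d + 1) Lc := ctrOff_mem_box (pos_Lc (Lc := Lc))
  obtain ⟨Cs, δs, hδs, hS⟩ := locStencil_sectorTable (d := d) (Lc := Lc) cΛt cE cΛ j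
  exact sum_box_literal_eq_reduced (μ := μ) (ν := ν) (α := α) (β := β) (one_le_of_neZero Lc) hr hS hδs
    (fun κ u v => sectorTable_translate (d := d) (Lc := Lc) cΛt cE cΛ j κ u v) (fun κ v y z a m => sectorTable_inl_inr (d := d) (Lc := Lc) cΛt cE cΛ j κ v y z a m)
    (fun κ v y z m b => sectorTable_inr_inl (d := d) (Lc := Lc) cΛt cE cΛ j κ v y z m b) sf sm (j + 1)

/-- [folklore] **`EE_swap(μ,ν;α,β)` IS THE REDUCED EXCHANGE WORD WITH THE BONDS EXCHANGED, `W(ν,μ;α,β)`** (every `j`, every axis pattern): the second summand of leaf-04's 33_j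
right side (cell index on the RIGHT bond `μ`, lattice sum on the LEFT bond `ν`) `=` the reduced word with `ν` on the cell bond and `μ` lattice-summed
(`ExchangeLatticeWordReduced.sum_box_swap_literal_eq_reduced`). -/
theorem eeSwap_eq_exchangeWord (cΛt sf sm cE cΛ : ℝ) (j : ℕ) (μ ν α β : Fin (d + 1)) :
    ∑ c' ∈ box (d + 1) Lc, ∑' u' : Site (d + 1), ∑' yw : Site (d + 1) × Site (d + 1), (if yw.1 α % (Lc : ℤ) = (Lc : ℤ) - 1 then (1 : ℝ) else 0) * (if yw.2 β % (Lc : ℤ) = (Lc : ℤ) - 1 then (1 : ℝ) else 0) *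
        comp (comp (vertexOfK (unitK sf sm (coDressKBmAt (toSite (ctrOff (d + 1) Lc)) Lc (KInvStep (d := d) Lc (j + 1)))) Lc
            (unitS sf sm (fun κ t => cE • e3OfK Lc (coDressKBmAt (toSite (ctrOff (d + 1) Lc)) Lc (KInvStep (d := d) Lc j))
              (fun κ u => comp (comp (trK (psiKS (ctrOff (d + 1) Lc) Lc)) (slotPsiS (ctrOff (d + 1) Lc) Lc (ScombOf (symTablesAn1S2 d Lc cΛt) ((Lc : ℝ) ^ (d + 1)) (-((Lc : ℝ) ^ (d + 1) * (1 / 2) * (Lc : ℝ) ^ (d + 1))) cΛ j) κ u)) (psiKS (ctrOff (d + 1) Lc) Lc)) κ t)) ν u')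
          (unitK sf sm (coDressKBmAt (toSite (ctrOff (d + 1) Lc)) Lc (KInvStep (d := d) Lc (j + 1)))))
          (vertexOfK (unitK sf sm (coDressKBmAt (toSite (ctrOff (d + 1) Lc)) Lc (KInvStep (d := d) Lc (j + 1)))) Lc
            (unitS sf sm (fun κ t => cE • e3OfK Lc (coDressKBmAt (toSite (ctrOff (d + 1) Lc)) Lc (KInvStep (d := d) Lc j))
              (fun κ u => comp (comp (trK (psiKS (ctrOff (d + 1) Lc) Lc)) (slotPsiS (ctrOff (d + 1) Lc) Lc (ScombOf (symTablesAn1S2 d Lc cΛt) ((Lc : ℝ) ^ (d + 1)) (-((Lc : ℝ) ^ (d + 1) * (1 / 2) * (Lc : ℝ) ^ (d + 1))) cΛ j) κ u)) (psiKS (ctrOff (d + 1) Lc) Lc)) κ t)) μ (toSite c')) yw.1 yw.2 (Sum.inl α) (Sum.inl β) =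
      ∑ u ∈ box (d + 1) Lc, ∑' y₁ : Site (d + 1), ∑ a : Fin (d + 1),
        (∑' y : Site (d + 1), (if y α % (Lc : ℤ) = (Lc : ℤ) - 1 then (1 : ℝ) else 0) *
          vertexOfK (unitK sf sm (coDressKBmAt (toSite (ctrOff (d + 1) Lc)) Lc (KInvStep (d := d) Lc (j + 1)))) Lc
            (unitS sf sm (fun κ u => cE • e3OfK Lc (coDressKBmAt (toSite (ctrOff (d + 1) Lc)) Lc (KInvStep (d := d) Lc j))
              (fun κ u => comp (comp (trK (psiKS (ctrOff (d + 1) Lc) Lc)) (slotPsiS (ctrOff (d + 1) Lc) Lc (ScombOf (symTablesAn1S2 d Lc cΛt) ((Lc : ℝ) ^ (d + 1)) (-((Lc : ℝ) ^ (d + 1) * (1 / 2) * (Lc : ℝ) ^ (d + 1))) cΛ j) κ u)) (psiKS (ctrOff (d + 1) Lc) Lc)) κ u)) ν (toSite u) y y₁ (Sum.inl α) (Sum.inl a)) *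
        (∑' z : Site (d + 1), ∑ b : Fin (d + 1), unitK sf sm (coDressKBmAt (toSite (ctrOff (d + 1) Lc)) Lc (KInvStep (d := d) Lc (j + 1))) y₁ z (Sum.inl a) (Sum.inl b) *
          (∑' u' : Site (d + 1), ∑' w : Site (d + 1), (if w β % (Lc : ℤ) = (Lc : ℤ) - 1 then (1 : ℝ) else 0) *
            vertexOfK (unitK sf sm (coDressKBmAt (toSite (ctrOff (d + 1) Lc)) Lc (KInvStep (d := d) Lc (j + 1)))) Lc
              (unitS sf sm (fun κ u => cE • e3OfK Lc (coDressKBmAt (toSite (ctrOff (d + 1) Lc)) Lc (KInvStep (d := d) Lc j))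
                (fun κ u => comp (comp (trK (psiKS (ctrOff (d + 1) Lc) Lc)) (slotPsiS (ctrOff (d + 1) Lc) Lc (ScombOf (symTablesAn1S2 d Lc cΛt) ((Lc : ℝ) ^ (d + 1)) (-((Lc : ℝ) ^ (d + 1) * (1 / 2) * (Lc : ℝ) ^ (d + 1))) cΛ j) κ u)) (psiKS (ctrOff (d + 1) Lc) Lc)) κ u)) μ u' z w (Sum.inl b) (Sum.inl β))) := by
  have hr : ctrOff (d + 1) Lc ∈ box (d + 1) Lc := ctrOff_mem_box (pos_Lc (Lc := Lc))
  obtain ⟨Cs, δs, hδs, hS⟩ := locStencil_sectorTable (d := d) (Lc := Lc) cΛt cE cΛ j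
  exact sum_box_swap_literal_eq_reduced (μ := μ) (ν := ν) (α := α) (β := β) (one_le_of_neZero Lc) hr hS hδs
    (fun κ u v => sectorTable_translate (d := d) (Lc := Lc) cΛt cE cΛ j κ u v) (fun κ v y z a m => sectorTable_inl_inr (d := d) (Lc := Lc) cΛt cE cΛ j κ v y z a m)
    (fun κ v y z m b => sectorTable_inr_inl (d := d) (Lc := Lc) cΛt cE cΛ j κ v y z m b) sf sm (j + 1)

/-! ## §3 The entrywise antisymmetric pair form -/

/-- [folklore] **THE REDUCED EXCHANGE WORD IS THE PAIR ENTRY `R(μα;νβ)` ON EVERY PATTERN**: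
`W(μ,ν;α,β) = if μ = α ∨ ν = β then 0 else |box|·c₀σ_{j+1}²·(K_E(−½))(K_E·½)·(s_f²·(wVH_{j+1}⁻¹·P(μα;νβ)))` — `exchangeWord_sector_value` off the diagonals,
`exchangeWord_sector_eq_zero_of_left_diag ∕ _right_diag` on them. -/
theorem exchangeWord_eq_pairEntry (cΛt sf sm cE cΛ : ℝ) (j : ℕ) (μ ν α β : Fin (d + 1)) :
    ∑ u ∈ box (d + 1) Lc, ∑' y₁ : Site (d + 1), ∑ a : Fin (d + 1),
        (∑' y : Site (d + 1), (if y α % (Lc : ℤ) = (Lc : ℤ) - 1 then (1 : ℝ) else 0) *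
          vertexOfK (unitK sf sm (coDressKBmAt (toSite (ctrOff (d + 1) Lc)) Lc (KInvStep (d := d) Lc (j + 1)))) Lc
            (unitS sf sm (fun κ u => cE • e3OfK Lc (coDressKBmAt (toSite (ctrOff (d + 1) Lc)) Lc (KInvStep (d := d) Lc j))
              (fun κ u => comp (comp (trK (psiKS (ctrOff (d + 1) Lc) Lc)) (slotPsiS (ctrOff (d + 1) Lc) Lc (ScombOf (symTablesAn1S2 d Lc cΛt) ((Lc : ℝ) ^ (d + 1)) (-((Lc : ℝ) ^ (d + 1) * (1 / 2) * (Lc : ℝ) ^ (d + 1))) cΛ j) κ u)) (psiKS (ctrOff (d + 1) Lc) Lc)) κ u)) μ (toSite u) y y₁ (Sum.inl α) (Sum.inl a)) *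
        (∑' z : Site (d + 1), ∑ b : Fin (d + 1), unitK sf sm (coDressKBmAt (toSite (ctrOff (d + 1) Lc)) Lc (KInvStep (d := d) Lc (j + 1))) y₁ z (Sum.inl a) (Sum.inl b) *
          (∑' u' : Site (d + 1), ∑' w : Site (d + 1), (if w β % (Lc : ℤ) = (Lc : ℤ) - 1 then (1 : ℝ) else 0) *
            vertexOfK (unitK sf sm (coDressKBmAt (toSite (ctrOff (d + 1) Lc)) Lc (KInvStep (d := d) Lc (j + 1)))) Lc
              (unitS sf sm (fun κ u => cE • e3OfK Lc (coDressKBmAt (toSite (ctrOff (d + 1) Lc)) Lc (KInvStep (d := d) Lc j))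
                (fun κ u => comp (comp (trK (psiKS (ctrOff (d + 1) Lc) Lc)) (slotPsiS (ctrOff (d + 1) Lc) Lc (ScombOf (symTablesAn1S2 d Lc cΛt) ((Lc : ℝ) ^ (d + 1)) (-((Lc : ℝ) ^ (d + 1) * (1 / 2) * (Lc : ℝ) ^ (d + 1))) cΛ j) κ u)) (psiKS (ctrOff (d + 1) Lc) Lc)) κ u)) ν u' z w (Sum.inl b) (Sum.inl β))) =
      if μ = α ∨ ν = β then 0 else
        ((box (d + 1) Lc).card : ℝ) * (((Lc : ℝ) * (sm * sf)) * ((((Lc ^ (j + 1 + 1) : ℕ) : ℝ)) ^ (d + 1 + 1))⁻¹) ^ 2 *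
          ((((sf * sm)⁻¹ * (sf⁻¹ * sf⁻¹) * cE) * (-(1 / 2 : ℝ))) * (((sf * sm)⁻¹ * (sf⁻¹ * sf⁻¹) * cE) * (1 / 2 : ℝ)) *
            ((sf * sf) * ((wVH d Lc (j + 1))⁻¹ *
              ∑ x ∈ box (d + 1) Lc, ∑ b : Fin (d + 1),
                ((if b = μ then ((Lc : ℝ)⁻¹ * (Lc : ℝ)⁻¹) * ((((toSite x α % (Lc : ℤ) : ℤ) : ℝ) - ((Lc : ℝ) - 1) / 2)) else 0)
                  + (if b = α then (-(Lc : ℝ)⁻¹ * ((((toSite x μ % (Lc : ℤ) : ℤ) : ℝ) - ((Lc : ℝ) - 1) / 2))) * (if toSite x α % (Lc : ℤ) = (Lc : ℤ) - 1 then (1 : ℝ) else 0) else 0)) *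
                ∑' s : Site (d + 1), ∑ b' : Fin (d + 1), E2 d Lc (j + 1) (toSite x) s (Sum.inl b) (Sum.inl b') *
                  ((if b' = ν then ((Lc : ℝ)⁻¹ * (Lc : ℝ)⁻¹) * ((((s β % (Lc : ℤ) : ℤ) : ℝ) - ((Lc : ℝ) - 1) / 2)) else 0)
                    + (if b' = β then (-(Lc : ℝ)⁻¹ * ((((s ν % (Lc : ℤ) : ℤ) : ℝ) - ((Lc : ℝ) - 1) / 2))) * (if s β % (Lc : ℤ) = (Lc : ℤ) - 1 then (1 : ℝ) else 0) else 0))))) := by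
  by_cases hμα : μ = α
  · subst hμα
    rw [if_pos (Or.inl rfl)]
    exact exchangeWord_sector_eq_zero_of_left_diag cΛt sf sm cE cΛ j μ ν β
  · by_cases hνβ : ν = β
    · subst hνβ
      rw [if_pos (Or.inr rfl)]
      exact exchangeWord_sector_eq_zero_of_right_diag cΛt sf sm cE cΛ j μ α ν
    · rw [if_neg (not_or.mpr ⟨hμα, hνβ⟩)]
      exact exchangeWord_sector_value cΛt sf sm cE cΛ j hμα hνβ

/-- [folklore] **THE TWO EE LATTICE WORDS AS AN EXPLICIT ENTRYWISE PAIR FORM** (every `j`, in-block root, all units, any amplitude `cE`, any `cΛ`, ALL `κ κ′ κ₁ κ₂`):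
`EE_direct(κ,κ′;κ₁,κ₂) + EE_swap(κ,κ′;κ₁,κ₂) = R(κκ₁;κ′κ₂) + R(κ′κ₁;κκ₂)` with the pair entry `R(μα;νβ) = if μ = α ∨ ν = β then 0 else |box|·c₀σ_{j+1}²·(K_E(−½))(K_E·½)·s_f²·wVH_{j+1}⁻¹·P(μα;νβ)`
WRITTEN OUT (the crossed scalar road-P2's `hSrcX` must cancel is read off here: `R(ba;ab) = −R(ab;ab)`); §2 twice and `exchangeWord_eq_pairEntry` twice. -/
theorem eeWords_eq_pairForm (cΛt sf sm cE cΛ : ℝ) (j : ℕ) (κ κ' κ₁ κ₂ : Fin (d + 1)) :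
    ∑ c' ∈ box (d + 1) Lc, ∑' u' : Site (d + 1), ∑' yw : Site (d + 1) × Site (d + 1), (if yw.1 κ₁ % (Lc : ℤ) = (Lc : ℤ) - 1 then (1 : ℝ) else 0) * (if yw.2 κ₂ % (Lc : ℤ) = (Lc : ℤ) - 1 then (1 : ℝ) else 0) *
            comp (comp (vertexOfK (unitK sf sm (coDressKBmAt (toSite (ctrOff (d + 1) Lc)) Lc (KInvStep (d := d) Lc (j + 1)))) Lc
                (unitS sf sm (fun κ t => cE • e3OfK Lc (coDressKBmAt (toSite (ctrOff (d + 1) Lc)) Lc (KInvStep (d := d) Lc j))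
                  (fun κ u => comp (comp (trK (psiKS (ctrOff (d + 1) Lc) Lc)) (slotPsiS (ctrOff (d + 1) Lc) Lc (ScombOf (symTablesAn1S2 d Lc cΛt) ((Lc : ℝ) ^ (d + 1)) (-((Lc : ℝ) ^ (d + 1) * (1 / 2) * (Lc : ℝ) ^ (d + 1))) cΛ j) κ u)) (psiKS (ctrOff (d + 1) Lc) Lc)) κ t)) κ (toSite c'))
              (unitK sf sm (coDressKBmAt (toSite (ctrOff (d + 1) Lc)) Lc (KInvStep (d := d) Lc (j + 1)))))
              (vertexOfK (unitK sf sm (coDressKBmAt (toSite (ctrOff (d + 1) Lc)) Lc (KInvStep (d := d) Lc (j + 1)))) Lc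
                (unitS sf sm (fun κ t => cE • e3OfK Lc (coDressKBmAt (toSite (ctrOff (d + 1) Lc)) Lc (KInvStep (d := d) Lc j))
                  (fun κ u => comp (comp (trK (psiKS (ctrOff (d + 1) Lc) Lc)) (slotPsiS (ctrOff (d + 1) Lc) Lc (ScombOf (symTablesAn1S2 d Lc cΛt) ((Lc : ℝ) ^ (d + 1)) (-((Lc : ℝ) ^ (d + 1) * (1 / 2) * (Lc : ℝ) ^ (d + 1))) cΛ j) κ u)) (psiKS (ctrOff (d + 1) Lc) Lc)) κ t)) κ' u') yw.1 yw.2 (Sum.inl κ₁) (Sum.inl κ₂) +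
          ∑ c' ∈ box (d + 1) Lc, ∑' u' : Site (d + 1), ∑' yw : Site (d + 1) × Site (d + 1), (if yw.1 κ₁ % (Lc : ℤ) = (Lc : ℤ) - 1 then (1 : ℝ) else 0) * (if yw.2 κ₂ % (Lc : ℤ) = (Lc : ℤ) - 1 then (1 : ℝ) else 0) *
            comp (comp (vertexOfK (unitK sf sm (coDressKBmAt (toSite (ctrOff (d + 1) Lc)) Lc (KInvStep (d := d) Lc (j + 1)))) Lc
                (unitS sf sm (fun κ t => cE • e3OfK Lc (coDressKBmAt (toSite (ctrOff (d + 1) Lc)) Lc (KInvStep (d := d) Lc j))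
                  (fun κ u => comp (comp (trK (psiKS (ctrOff (d + 1) Lc) Lc)) (slotPsiS (ctrOff (d + 1) Lc) Lc (ScombOf (symTablesAn1S2 d Lc cΛt) ((Lc : ℝ) ^ (d + 1)) (-((Lc : ℝ) ^ (d + 1) * (1 / 2) * (Lc : ℝ) ^ (d + 1))) cΛ j) κ u)) (psiKS (ctrOff (d + 1) Lc) Lc)) κ t)) κ' u')
              (unitK sf sm (coDressKBmAt (toSite (ctrOff (d + 1) Lc)) Lc (KInvStep (d := d) Lc (j + 1)))))
              (vertexOfK (unitK sf sm (coDressKBmAt (toSite (ctrOff (d + 1) Lc)) Lc (KInvStep (d := d) Lc (j + 1)))) Lc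
                (unitS sf sm (fun κ t => cE • e3OfK Lc (coDressKBmAt (toSite (ctrOff (d + 1) Lc)) Lc (KInvStep (d := d) Lc j))
                  (fun κ u => comp (comp (trK (psiKS (ctrOff (d + 1) Lc) Lc)) (slotPsiS (ctrOff (d + 1) Lc) Lc (ScombOf (symTablesAn1S2 d Lc cΛt) ((Lc : ℝ) ^ (d + 1)) (-((Lc : ℝ) ^ (d + 1) * (1 / 2) * (Lc : ℝ) ^ (d + 1))) cΛ j) κ u)) (psiKS (ctrOff (d + 1) Lc) Lc)) κ t)) κ (toSite c')) yw.1 yw.2 (Sum.inl κ₁) (Sum.inl κ₂) =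
      (if κ = κ₁ ∨ κ' = κ₂ then 0 else
        ((box (d + 1) Lc).card : ℝ) * (((Lc : ℝ) * (sm * sf)) * ((((Lc ^ (j + 1 + 1) : ℕ) : ℝ)) ^ (d + 1 + 1))⁻¹) ^ 2 *
          ((((sf * sm)⁻¹ * (sf⁻¹ * sf⁻¹) * cE) * (-(1 / 2 : ℝ))) * (((sf * sm)⁻¹ * (sf⁻¹ * sf⁻¹) * cE) * (1 / 2 : ℝ)) *
            ((sf * sf) * ((wVH d Lc (j + 1))⁻¹ *
              ∑ x ∈ box (d + 1) Lc, ∑ b : Fin (d + 1),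
                ((if b = κ then ((Lc : ℝ)⁻¹ * (Lc : ℝ)⁻¹) * ((((toSite x κ₁ % (Lc : ℤ) : ℤ) : ℝ) - ((Lc : ℝ) - 1) / 2)) else 0)
                  + (if b = κ₁ then (-(Lc : ℝ)⁻¹ * ((((toSite x κ % (Lc : ℤ) : ℤ) : ℝ) - ((Lc : ℝ) - 1) / 2))) * (if toSite x κ₁ % (Lc : ℤ) = (Lc : ℤ) - 1 then (1 : ℝ) else 0) else 0)) *
                ∑' s : Site (d + 1), ∑ b' : Fin (d + 1), E2 d Lc (j + 1) (toSite x) s (Sum.inl b) (Sum.inl b') *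
                  ((if b' = κ' then ((Lc : ℝ)⁻¹ * (Lc : ℝ)⁻¹) * ((((s κ₂ % (Lc : ℤ) : ℤ) : ℝ) - ((Lc : ℝ) - 1) / 2)) else 0)
                    + (if b' = κ₂ then (-(Lc : ℝ)⁻¹ * ((((s κ' % (Lc : ℤ) : ℤ) : ℝ) - ((Lc : ℝ) - 1) / 2))) * (if s κ₂ % (Lc : ℤ) = (Lc : ℤ) - 1 then (1 : ℝ) else 0) else 0)))))) +
      (if κ' = κ₁ ∨ κ = κ₂ then 0 else
        ((box (d + 1) Lc).card : ℝ) * (((Lc : ℝ) * (sm * sf)) * ((((Lc ^ (j + 1 + 1) : ℕ) : ℝ)) ^ (d + 1 + 1))⁻¹) ^ 2 *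
          ((((sf * sm)⁻¹ * (sf⁻¹ * sf⁻¹) * cE) * (-(1 / 2 : ℝ))) * (((sf * sm)⁻¹ * (sf⁻¹ * sf⁻¹) * cE) * (1 / 2 : ℝ)) *
            ((sf * sf) * ((wVH d Lc (j + 1))⁻¹ *
              ∑ x ∈ box (d + 1) Lc, ∑ b : Fin (d + 1),
                ((if b = κ' then ((Lc : ℝ)⁻¹ * (Lc : ℝ)⁻¹) * ((((toSite x κ₁ % (Lc : ℤ) : ℤ) : ℝ) - ((Lc : ℝ) - 1) / 2)) else 0)
                  + (if b = κ₁ then (-(Lc : ℝ)⁻¹ * ((((toSite x κ' % (Lc : ℤ) : ℤ) : ℝ) - ((Lc : ℝ) - 1) / 2))) * (if toSite x κ₁ % (Lc : ℤ) = (Lc : ℤ) - 1 then (1 : ℝ) else 0) else 0)) *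
                ∑' s : Site (d + 1), ∑ b' : Fin (d + 1), E2 d Lc (j + 1) (toSite x) s (Sum.inl b) (Sum.inl b') *
                  ((if b' = κ then ((Lc : ℝ)⁻¹ * (Lc : ℝ)⁻¹) * ((((s κ₂ % (Lc : ℤ) : ℤ) : ℝ) - ((Lc : ℝ) - 1) / 2)) else 0)
                    + (if b' = κ₂ then (-(Lc : ℝ)⁻¹ * ((((s κ % (Lc : ℤ) : ℤ) : ℝ) - ((Lc : ℝ) - 1) / 2))) * (if s κ₂ % (Lc : ℤ) = (Lc : ℤ) - 1 then (1 : ℝ) else 0) else 0)))))) := by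
  rw [eeDirect_eq_exchangeWord cΛt sf sm cE cΛ j κ κ' κ₁ κ₂, eeSwap_eq_exchangeWord cΛt sf sm cE cΛ j κ κ' κ₁ κ₂,
    exchangeWord_eq_pairEntry cΛt sf sm cE cΛ j κ κ' κ₁ κ₂, exchangeWord_eq_pairEntry cΛt sf sm cE cΛ j κ' κ κ₁ κ₂]

/-- [folklore] **THE TWO EE LATTICE WORDS OF THE DRESSED LEVEL-`(j+1)` SOURCE ARE AN ENTRYWISE ANTISYMMETRIC PAIR FORM** (every `j`, in-block root, all units, any amplitude `cE`, any
`cΛ`; ALL `κ κ′ κ₁ κ₂`): with `R(μα;νβ) := [μ≠α][ν≠β]·|box|·c₀σ_{j+1}²·(K_E(−½))(K_E·½)·s_f²·wVH_{j+1}⁻¹·P(μα;νβ)`,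
`EE_direct(κ,κ′;κ₁,κ₂) + EE_swap(κ,κ′;κ₁,κ₂) = R(κκ₁;κ′κ₂) + R(κ′κ₁;κκ₂)`, and `R` is antisymmetric in each pair (`pairEntry_antisymm_fst ∕ _snd`) — the input of road-P2's
`CombChargeAntisymPairForm.pairFormLS_of_pairForm` ∕ `crossed_entries_of_pairForm`, i.e. the output shape of its `exists_pairForm_of_word`. -/
theorem exists_pairForm_eeWords (cΛt sf sm cE cΛ : ℝ) (j : ℕ) :
    ∃ R : Fin (d + 1) → Fin (d + 1) → Fin (d + 1) → Fin (d + 1) → ℝ,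
      (∀ a b c e, R b a c e = -R a b c e) ∧ (∀ a b c e, R a b e c = -R a b c e) ∧
      ∀ κ κ' κ₁ κ₂ : Fin (d + 1),
        (∑ c' ∈ box (d + 1) Lc, ∑' u' : Site (d + 1), ∑' yw : Site (d + 1) × Site (d + 1), (if yw.1 κ₁ % (Lc : ℤ) = (Lc : ℤ) - 1 then (1 : ℝ) else 0) * (if yw.2 κ₂ % (Lc : ℤ) = (Lc : ℤ) - 1 then (1 : ℝ) else 0) *
            comp (comp (vertexOfK (unitK sf sm (coDressKBmAt (toSite (ctrOff (d + 1) Lc)) Lc (KInvStep (d := d) Lc (j + 1)))) Lc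
                (unitS sf sm (fun κ t => cE • e3OfK Lc (coDressKBmAt (toSite (ctrOff (d + 1) Lc)) Lc (KInvStep (d := d) Lc j))
                  (fun κ u => comp (comp (trK (psiKS (ctrOff (d + 1) Lc) Lc)) (slotPsiS (ctrOff (d + 1) Lc) Lc (ScombOf (symTablesAn1S2 d Lc cΛt) ((Lc : ℝ) ^ (d + 1)) (-((Lc : ℝ) ^ (d + 1) * (1 / 2) * (Lc : ℝ) ^ (d + 1))) cΛ j) κ u)) (psiKS (ctrOff (d + 1) Lc) Lc)) κ t)) κ (toSite c'))
              (unitK sf sm (coDressKBmAt (toSite (ctrOff (d + 1) Lc)) Lc (KInvStep (d := d) Lc (j + 1)))))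
              (vertexOfK (unitK sf sm (coDressKBmAt (toSite (ctrOff (d + 1) Lc)) Lc (KInvStep (d := d) Lc (j + 1)))) Lc
                (unitS sf sm (fun κ t => cE • e3OfK Lc (coDressKBmAt (toSite (ctrOff (d + 1) Lc)) Lc (KInvStep (d := d) Lc j))
                  (fun κ u => comp (comp (trK (psiKS (ctrOff (d + 1) Lc) Lc)) (slotPsiS (ctrOff (d + 1) Lc) Lc (ScombOf (symTablesAn1S2 d Lc cΛt) ((Lc : ℝ) ^ (d + 1)) (-((Lc : ℝ) ^ (d + 1) * (1 / 2) * (Lc : ℝ) ^ (d + 1))) cΛ j) κ u)) (psiKS (ctrOff (d + 1) Lc) Lc)) κ t)) κ' u') yw.1 yw.2 (Sum.inl κ₁) (Sum.inl κ₂) +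
          ∑ c' ∈ box (d + 1) Lc, ∑' u' : Site (d + 1), ∑' yw : Site (d + 1) × Site (d + 1), (if yw.1 κ₁ % (Lc : ℤ) = (Lc : ℤ) - 1 then (1 : ℝ) else 0) * (if yw.2 κ₂ % (Lc : ℤ) = (Lc : ℤ) - 1 then (1 : ℝ) else 0) *
            comp (comp (vertexOfK (unitK sf sm (coDressKBmAt (toSite (ctrOff (d + 1) Lc)) Lc (KInvStep (d := d) Lc (j + 1)))) Lc
                (unitS sf sm (fun κ t => cE • e3OfK Lc (coDressKBmAt (toSite (ctrOff (d + 1) Lc)) Lc (KInvStep (d := d) Lc j))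
                  (fun κ u => comp (comp (trK (psiKS (ctrOff (d + 1) Lc) Lc)) (slotPsiS (ctrOff (d + 1) Lc) Lc (ScombOf (symTablesAn1S2 d Lc cΛt) ((Lc : ℝ) ^ (d + 1)) (-((Lc : ℝ) ^ (d + 1) * (1 / 2) * (Lc : ℝ) ^ (d + 1))) cΛ j) κ u)) (psiKS (ctrOff (d + 1) Lc) Lc)) κ t)) κ' u')
              (unitK sf sm (coDressKBmAt (toSite (ctrOff (d + 1) Lc)) Lc (KInvStep (d := d) Lc (j + 1)))))
              (vertexOfK (unitK sf sm (coDressKBmAt (toSite (ctrOff (d + 1) Lc)) Lc (KInvStep (d := d) Lc (j + 1)))) Lc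
                (unitS sf sm (fun κ t => cE • e3OfK Lc (coDressKBmAt (toSite (ctrOff (d + 1) Lc)) Lc (KInvStep (d := d) Lc j))
                  (fun κ u => comp (comp (trK (psiKS (ctrOff (d + 1) Lc) Lc)) (slotPsiS (ctrOff (d + 1) Lc) Lc (ScombOf (symTablesAn1S2 d Lc cΛt) ((Lc : ℝ) ^ (d + 1)) (-((Lc : ℝ) ^ (d + 1) * (1 / 2) * (Lc : ℝ) ^ (d + 1))) cΛ j) κ u)) (psiKS (ctrOff (d + 1) Lc) Lc)) κ t)) κ (toSite c')) yw.1 yw.2 (Sum.inl κ₁) (Sum.inl κ₂)) =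
        R κ κ₁ κ' κ₂ + R κ' κ₁ κ κ₂ := by
  refine ⟨fun μ α ν β => if μ = α ∨ ν = β then 0 else
        ((box (d + 1) Lc).card : ℝ) * (((Lc : ℝ) * (sm * sf)) * ((((Lc ^ (j + 1 + 1) : ℕ) : ℝ)) ^ (d + 1 + 1))⁻¹) ^ 2 *
          ((((sf * sm)⁻¹ * (sf⁻¹ * sf⁻¹) * cE) * (-(1 / 2 : ℝ))) * (((sf * sm)⁻¹ * (sf⁻¹ * sf⁻¹) * cE) * (1 / 2 : ℝ)) *
            ((sf * sf) * ((wVH d Lc (j + 1))⁻¹ *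
              ∑ x ∈ box (d + 1) Lc, ∑ b : Fin (d + 1),
                ((if b = μ then ((Lc : ℝ)⁻¹ * (Lc : ℝ)⁻¹) * ((((toSite x α % (Lc : ℤ) : ℤ) : ℝ) - ((Lc : ℝ) - 1) / 2)) else 0)
                  + (if b = α then (-(Lc : ℝ)⁻¹ * ((((toSite x μ % (Lc : ℤ) : ℤ) : ℝ) - ((Lc : ℝ) - 1) / 2))) * (if toSite x α % (Lc : ℤ) = (Lc : ℤ) - 1 then (1 : ℝ) else 0) else 0)) *
                ∑' s : Site (d + 1), ∑ b' : Fin (d + 1), E2 d Lc (j + 1) (toSite x) s (Sum.inl b) (Sum.inl b') *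
                  ((if b' = ν then ((Lc : ℝ)⁻¹ * (Lc : ℝ)⁻¹) * ((((s β % (Lc : ℤ) : ℤ) : ℝ) - ((Lc : ℝ) - 1) / 2)) else 0)
                    + (if b' = β then (-(Lc : ℝ)⁻¹ * ((((s ν % (Lc : ℤ) : ℤ) : ℝ) - ((Lc : ℝ) - 1) / 2))) * (if s β % (Lc : ℤ) = (Lc : ℤ) - 1 then (1 : ℝ) else 0) else 0))))),
    fun a b c e => pairEntry_antisymm_fst (Lc := Lc) sf sm cE j a b c e, fun a b c e => pairEntry_antisymm_snd (Lc := Lc) sf sm cE j a b c e, fun κ κ' κ₁ κ₂ => ?_⟩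
  rw [eeDirect_eq_exchangeWord cΛt sf sm cE cΛ j κ κ' κ₁ κ₂, eeSwap_eq_exchangeWord cΛt sf sm cE cΛ j κ κ' κ₁ κ₂,
    exchangeWord_eq_pairEntry cΛt sf sm cE cΛ j κ κ' κ₁ κ₂, exchangeWord_eq_pairEntry cΛt sf sm cE cΛ j κ' κ κ₁ κ₂]

/-- [folklore] **THE SAME AFTER AN OVERALL SCALAR** (for the prefactor `c·(−(s_f s_m σ_{j+1})²Lc²)` of leaf-04's 33_j; forms scale): for every `c'`,
`c₀·(EE_direct + EE_swap)(κ,κ′;κ₁,κ₂) = R′(κκ₁;κ′κ₂) + R′(κ′κ₁;κκ₂)` with `R′ = c₀·R` antisymmetric in each pair. -/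
theorem exists_pairForm_eeWords_smul (cΛt sf sm cE cΛ : ℝ) (j : ℕ) (c₀ : ℝ) :
    ∃ R : Fin (d + 1) → Fin (d + 1) → Fin (d + 1) → Fin (d + 1) → ℝ,
      (∀ a b c e, R b a c e = -R a b c e) ∧ (∀ a b c e, R a b e c = -R a b c e) ∧
      ∀ κ κ' κ₁ κ₂ : Fin (d + 1),
        c₀ * (∑ c' ∈ box (d + 1) Lc, ∑' u' : Site (d + 1), ∑' yw : Site (d + 1) × Site (d + 1), (if yw.1 κ₁ % (Lc : ℤ) = (Lc : ℤ) - 1 then (1 : ℝ) else 0) * (if yw.2 κ₂ % (Lc : ℤ) = (Lc : ℤ) - 1 then (1 : ℝ) else 0) *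
            comp (comp (vertexOfK (unitK sf sm (coDressKBmAt (toSite (ctrOff (d + 1) Lc)) Lc (KInvStep (d := d) Lc (j + 1)))) Lc
                (unitS sf sm (fun κ t => cE • e3OfK Lc (coDressKBmAt (toSite (ctrOff (d + 1) Lc)) Lc (KInvStep (d := d) Lc j))
                  (fun κ u => comp (comp (trK (psiKS (ctrOff (d + 1) Lc) Lc)) (slotPsiS (ctrOff (d + 1) Lc) Lc (ScombOf (symTablesAn1S2 d Lc cΛt) ((Lc : ℝ) ^ (d + 1)) (-((Lc : ℝ) ^ (d + 1) * (1 / 2) * (Lc : ℝ) ^ (d + 1))) cΛ j) κ u)) (psiKS (ctrOff (d + 1) Lc) Lc)) κ t)) κ (toSite c'))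
              (unitK sf sm (coDressKBmAt (toSite (ctrOff (d + 1) Lc)) Lc (KInvStep (d := d) Lc (j + 1)))))
              (vertexOfK (unitK sf sm (coDressKBmAt (toSite (ctrOff (d + 1) Lc)) Lc (KInvStep (d := d) Lc (j + 1)))) Lc
                (unitS sf sm (fun κ t => cE • e3OfK Lc (coDressKBmAt (toSite (ctrOff (d + 1) Lc)) Lc (KInvStep (d := d) Lc j))
                  (fun κ u => comp (comp (trK (psiKS (ctrOff (d + 1) Lc) Lc)) (slotPsiS (ctrOff (d + 1) Lc) Lc (ScombOf (symTablesAn1S2 d Lc cΛt) ((Lc : ℝ) ^ (d + 1)) (-((Lc : ℝ) ^ (d + 1) * (1 / 2) * (Lc : ℝ) ^ (d + 1))) cΛ j) κ u)) (psiKS (ctrOff (d + 1) Lc) Lc)) κ t)) κ' u') yw.1 yw.2 (Sum.inl κ₁) (Sum.inl κ₂) +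
          ∑ c' ∈ box (d + 1) Lc, ∑' u' : Site (d + 1), ∑' yw : Site (d + 1) × Site (d + 1), (if yw.1 κ₁ % (Lc : ℤ) = (Lc : ℤ) - 1 then (1 : ℝ) else 0) * (if yw.2 κ₂ % (Lc : ℤ) = (Lc : ℤ) - 1 then (1 : ℝ) else 0) *
            comp (comp (vertexOfK (unitK sf sm (coDressKBmAt (toSite (ctrOff (d + 1) Lc)) Lc (KInvStep (d := d) Lc (j + 1)))) Lc
                (unitS sf sm (fun κ t => cE • e3OfK Lc (coDressKBmAt (toSite (ctrOff (d + 1) Lc)) Lc (KInvStep (d := d) Lc j))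
                  (fun κ u => comp (comp (trK (psiKS (ctrOff (d + 1) Lc) Lc)) (slotPsiS (ctrOff (d + 1) Lc) Lc (ScombOf (symTablesAn1S2 d Lc cΛt) ((Lc : ℝ) ^ (d + 1)) (-((Lc : ℝ) ^ (d + 1) * (1 / 2) * (Lc : ℝ) ^ (d + 1))) cΛ j) κ u)) (psiKS (ctrOff (d + 1) Lc) Lc)) κ t)) κ' u')
              (unitK sf sm (coDressKBmAt (toSite (ctrOff (d + 1) Lc)) Lc (KInvStep (d := d) Lc (j + 1)))))
              (vertexOfK (unitK sf sm (coDressKBmAt (toSite (ctrOff (d + 1) Lc)) Lc (KInvStep (d := d) Lc (j + 1)))) Lc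
                (unitS sf sm (fun κ t => cE • e3OfK Lc (coDressKBmAt (toSite (ctrOff (d + 1) Lc)) Lc (KInvStep (d := d) Lc j))
                  (fun κ u => comp (comp (trK (psiKS (ctrOff (d + 1) Lc) Lc)) (slotPsiS (ctrOff (d + 1) Lc) Lc (ScombOf (symTablesAn1S2 d Lc cΛt) ((Lc : ℝ) ^ (d + 1)) (-((Lc : ℝ) ^ (d + 1) * (1 / 2) * (Lc : ℝ) ^ (d + 1))) cΛ j) κ u)) (psiKS (ctrOff (d + 1) Lc) Lc)) κ t)) κ (toSite c')) yw.1 yw.2 (Sum.inl κ₁) (Sum.inl κ₂)) =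
        R κ κ₁ κ' κ₂ + R κ' κ₁ κ κ₂ := by
  obtain ⟨R, hR1, hR2, hE⟩ := exists_pairForm_eeWords (d := d) (Lc := Lc) cΛt sf sm cE cΛ j
  refine ⟨fun a b c e => c₀ * R a b c e, fun a b c e => ?_, fun a b c e => ?_, fun κ κ' κ₁ κ₂ => ?_⟩
  · show c₀ * R b a c e = -(c₀ * R a b c e)
    rw [hR1]; ring
  · show c₀ * R a b e c = -(c₀ * R a b c e)
    rw [hR2]; ring
  · rw [hE κ κ' κ₁ κ₂]
    show _ = c₀ * R κ κ₁ κ' κ₂ + c₀ * R κ' κ₁ κ κ₂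
    ring

end Summit.QuantumFields.BalabanUV.Beta.GAN24.CombExchangeESectorLatticeWords

end
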